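import Summits.ValiantsHypothesis.ValiantsHypothesis.Theses.GirthSidon

/-!
# Route GirthSidon — glue item `CruxGivesTarget`

Route `route-ValiantsHypothesis-GirthSidon`, item `stmt-ValiantsHypothesis-6543` (support glue).

`SwallowForcesShortRelation` (the family-free cancellation crux: a non-elusive monomial curve in the
regime `s ^ 10 ≤ m ^ 9` carries a short additive relation `Σ_S d = Σ_T d`, `S ≠ T`, `|S|, |T| ≤ 30`,
among its exponents) together with `MomentExponentsRelationFree` (the `B_30` property of the
power-sum code: such a relation among the exponents `Σ_{k<60} (i+1)^k m^{60k}` forces `S = T` once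
`m ≥ 60`) imply the target `MomentCurveElusive`.  Proof: take `m₀' = max m₀ 60` and argue by
contradiction.  No named facts are used; the theorem is unconditional glue.
-/

-- `Summit.<Summit>.<Problem>` repeats `ValiantsHypothesis` by the tree's layout convention (D-0017).
set_option linter.dupNamespace false

namespace Summit.ValiantsHypothesis.ValiantsHypothesis.Theorems

open Summit.ValiantsHypothesis.ValiantsHypothesis.Theses.GirthSidon

/-- Glue for route `GirthSidon` (item `CruxGivesTarget`):
`SwallowForcesShortRelation → MomentExponentsRelationFree → MomentCurveElusive`.
With `m₀` from the first hypothesis, set the threshold to `max m₀ 60`.  For `m ≥ max m₀ 60` and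
`s ^ 10 ≤ m ^ 9`, if the power-sum moment curve `x ↦ (x ^ d(m,i))_i`,
`d(m,i) = Σ_{k<60} (i+1)^k m^{60k}`, were not `(s, 2)`-elusive, the first hypothesis (applied to
`d := d(m,·)`) would give multisets `S ≠ T` over `Fin m` of size `≤ 30` with equal `d`-sums, and the
second hypothesis (as `m ≥ 60`) forces `S = T` — a contradiction. -/
theorem cruxGivesTarget_proof :
    Summit.ValiantsHypothesis.ValiantsHypothesis.Theses.GirthSidon.CruxGivesTarget := by
  unfold CruxGivesTarget
  intro hSwallow hFree
  obtain ⟨m₀, hm₀⟩ := hSwallow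
  refine ⟨max m₀ 60, fun m hm s hs => ?_⟩
  by_contra hne
  obtain ⟨S, T, hST, hS, hT, hsum⟩ :=
    hm₀ m (le_trans (le_max_left _ _) hm)
      (fun i : Fin m => ∑ k ∈ Finset.range 60, ((i : ℕ) + 1) ^ k * m ^ (60 * k)) s hs hne
  exact hST (hFree m (le_trans (le_max_right _ _) hm) S T hS hT hsum)

end Summit.ValiantsHypothesis.ValiantsHypothesis.Theorems
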